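import Literature.MathematicalPhysics.KineticTheory.SiteChainResponseIdentity
import Literature.MathematicalPhysics.KineticTheory.SiteChainGibbsWeight
import Mathlib.MeasureTheory.Integral.ExpDecay
import Mathlib.MeasureTheory.Integral.IntegralEqImproper
import HarnessLib

/-!
# The exact response identity (★) of a site-inhomogeneous chain under a mixing estimate

Topic `Literature/MathematicalPhysics/KineticTheory`, grouping namespace `…KineticTheory.HeatConduction`.
Fix a uniformly confining site-dependent chain (`N ≥ 1`, `γ > 0`), a temperature `T > 0`, a bias `δ ≠ 0`
with `T ± δ/2 ≥ 0`, the kernels `P^δ_s = langevinKernel N (T+δ/2) (T-δ/2) s`, and suppose a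
`V`-UNIFORM MIXING ESTIMATE towards a probability measure `ν` holds at these temperatures:
`|P^δ_t f(z) - ν(f)| ≤ C e^{ϑH(z)} e^{-ct}` for continuous `|f| ≤ e^{ϑH}` (`0 < ϑ < 1/T`, `c > 0`),
`ν(e^{ϑH}) ≤ C` (Cuneo–Eckmann–Hairer–Rey-Bellet 2018 Thm 2.13 eq. (2.5)); suppose `e^{aH} ∈ L¹(dx)`
for all `a < 0`. For an observable `φ ∈ C²` with `|φ| ≤ C_φ e^{ϑH}`, letting `t → ∞` in the
finite-time response identity (`SiteChainResponseIdentity.lean`) gives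

* `exists_decay_oddMoment_pairing_of_mixing` — exponential decay of `s ↦ ∫ P^δ_s φ · e^{-H/T}(p_0² - p_{N-1}²) dx`
  and of `∫ e^{-H/T} P^δ_s φ dx - ν(φ) Z` (`Z = ∫ e^{-H/T} dx`);
* `integrableOn_oddMoment_pairing_of_mixing` — the pairing is integrable on `(0, ∞)`;
* `forecast_limit_mul_partition_eq_of_mixing` — **★ in Lebesgue-weight form**:
  `ν(φ) · Z - ∫ e^{-H/T} φ dx = δ (γ/2T²) ∫₀^∞ ∫ P^δ_s φ · e^{-H/T}(p_0² - p_{N-1}²) dx ds`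
  (for the total current `φ = J` the second term vanishes, `SiteChainGibbsWeight.lean`, and `ν(J)`
  is the steady current: the whole `δ`-dependence of `ν_δ(J)/δ` sits in the kernels inside the
  pairing — no `o(δ)` term).

## References

* A. Kundu, A. Dhar, O. Narayan, J. Stat. Mech. (2009) L03001, p. 3.
* N. Cuneo, J.-P. Eckmann, M. Hairer, L. Rey-Bellet, Electron. J. Probab. **23** (2018) no. 55,
  Thm 2.13 eq. (2.5), §3.1.
* L. Rey-Bellet, *Open classical systems*, Lecture Notes in Math. 1881 (2006), Rem. 4.4.
-/

noncomputable section

open MeasureTheory ProbabilityTheory Filter Topology Set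
open scoped NNReal ENNReal ContDiff

namespace Literature.MathematicalPhysics.KineticTheory.HeatConduction

open Literature.Probability.Process Literature.MathematicalPhysics.KineticTheory

variable {N : ℕ}

namespace SiteChain.UniformlyConfining

variable {P : SiteChain} (hP : P.UniformlyConfining)

section Star

variable (hN : 0 < N) (hγ : 0 < P.γ) {T δ : ℝ} (hT : 0 < T) (hTL : 0 ≤ T + δ / 2) (hTR : 0 ≤ T - δ / 2)
  (hδ0 : δ ≠ 0) {ϑ C c : ℝ} (hϑ : 0 < ϑ) (hϑT : -1 / T + ϑ < 0) (hc : 0 < c)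
  {ν : Measure (PhaseSpace N)} [IsProbabilityMeasure ν]
  (hνC : ∫ y, Real.exp (ϑ * P.hamiltonian N y) ∂ν ≤ C)
  (hmix : ∀ (z : PhaseSpace N) (t : ℝ≥0) (f : PhaseSpace N → ℝ), Continuous f →
    (∀ y, |f y| ≤ Real.exp (ϑ * P.hamiltonian N y)) →
    |(∫ y, f y ∂(P.langevinKernel N (T + δ / 2) (T - δ / 2) t z)) - ∫ y, f y ∂ν| ≤
      C * Real.exp (ϑ * P.hamiltonian N z) * Real.exp (-c * t))
  (hZ : ∀ a : ℝ, a < 0 → Integrable fun x : PhaseSpace N => Real.exp (a * P.hamiltonian N x))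
  {φ : PhaseSpace N → ℝ} (hφ2 : ContDiff ℝ 2 φ) {Cφ : ℝ}
  (hφ : ∀ y, |φ y| ≤ Cφ * Real.exp (ϑ * P.hamiltonian N y))
include hP hN hγ hT hTL hTR hδ0 hϑ hϑT hc hνC hmix hZ hφ2 hφ

/-- **Exponential relaxation of the odd-moment pairing and of the weighted forecast.** There are
`K ≥ 0`, `c > 0` with, for all `s ≥ 0`: `|∫ P^δ_s φ · e^{-H/T}(p_0² - p_{N-1}²) dx| ≤ K e^{-cs}` and
`|∫ e^{-H/T} P^δ_s φ dx - ν(φ) ∫ e^{-H/T} dx| ≤ K e^{-cs}` (the mixing estimate for `f = φ/M`,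
`∫ e^{-H/T}(p_0² - p_{N-1}²) dx = 0`). [cite: CuneoEckmannHairerReyBellet2018, Thm 2.13 eq. (2.5)] -/
theorem exists_decay_oddMoment_pairing_of_mixing :
    ∃ K c' : ℝ, 0 ≤ K ∧ 0 < c' ∧
      (∀ s : ℝ≥0, |∫ x, (∫ y, φ y ∂(P.langevinKernel N (T + δ / 2) (T - δ / 2) s x)) *
          (Real.exp (-1 / T * P.hamiltonian N x) * (x.2 ⟨0, hN⟩ ^ 2 - x.2 ⟨N - 1, by omega⟩ ^ 2))| ≤
            K * Real.exp (-c' * s)) ∧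
      (∀ s : ℝ≥0, |(∫ x, Real.exp (-1 / T * P.hamiltonian N x) *
            ∫ y, φ y ∂(P.langevinKernel N (T + δ / 2) (T - δ / 2) s x)) -
          (∫ y, φ y ∂ν) * ∫ x, Real.exp (-1 / T * P.hamiltonian N x)| ≤ K * Real.exp (-c' * s)) := by
  set Hm := P.hamiltonian N with hHm
  obtain ⟨-, hK⟩ := hP.exp_moment_bound_of_mixing N (T + δ / 2) (T - δ / 2) hϑ.le hc.le hνC hmix
  have hK0 : (0 : ℝ) ≤ 2 * C := by
    have h := hmix 0 0 (fun _ => 0) continuous_const (fun y => by rw [abs_zero]; exact (Real.exp_pos _).le)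
    simp only [integral_zero, sub_self, abs_zero, NNReal.coe_zero, mul_zero, Real.exp_zero, mul_one] at h
    nlinarith [nonneg_of_mul_nonneg_left h (Real.exp_pos _)]
  -- `|φ| ≤ M e^{ϑH}` with `M > 0`
  set M : ℝ := |Cφ| + 1 with hMdef
  have hM : 0 < M := by positivity
  have hφM : ∀ y, |φ y| ≤ M * Real.exp (ϑ * Hm y) := fun y =>
    (hφ y).trans (mul_le_mul_of_nonneg_right (by rw [hMdef]; linarith [le_abs_self Cφ]) (Real.exp_pos _).le)
  have hφc : Continuous φ := hφ2.continuous
  have hφm := hφc.stronglyMeasurable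
  have hdecay : ∀ (s : ℝ≥0) (x : PhaseSpace N),
      |(∫ y, φ y ∂(P.langevinKernel N (T + δ / 2) (T - δ / 2) s x)) - ∫ y, φ y ∂ν| ≤
        M * C * Real.exp (ϑ * Hm x) * Real.exp (-c * s) := by
    intro s x
    have hf : ∀ y, |φ y / M| ≤ Real.exp (ϑ * Hm y) := fun y => by
      rw [abs_div, abs_of_pos hM, div_le_iff₀ hM, mul_comm]
      exact hφM y
    have h := hmix x s (fun y => φ y / M) (hφc.div_const M) hf
    rw [integral_div, integral_div, ← sub_div, abs_div, abs_of_pos hM, div_le_iff₀ hM] at h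
    calc _ ≤ C * Real.exp (ϑ * Hm x) * Real.exp (-c * s) * M := h
      _ = _ := by ring
  -- the integrable majorants
  have hI0 : Integrable fun x : PhaseSpace N => Real.exp ((-1 / T + ϑ) * Hm x) := hZ _ hϑT
  have hI1 : Integrable fun x : PhaseSpace N =>
      (1 + x.2 ⟨0, hN⟩ ^ 2 + x.2 ⟨N - 1, by omega⟩ ^ 2) * Real.exp ((-1 / T + ϑ) * Hm x) :=
    hP.integrable_momentSq_mul_exp_mul_hamiltonian hN hϑT (hZ _ (by linarith))
  set K₁ : ℝ := ∫ x, (1 + x.2 ⟨0, hN⟩ ^ 2 + x.2 ⟨N - 1, by omega⟩ ^ 2) * Real.exp ((-1 / T + ϑ) * Hm x) with hK₁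
  set K₀ : ℝ := ∫ x, Real.exp ((-1 / T + ϑ) * Hm x) with hK₀
  have hK₁0 : 0 ≤ K₁ := integral_nonneg fun x => by positivity
  have hK₀0 : 0 ≤ K₀ := integral_nonneg fun x => by positivity
  have hC0 : 0 ≤ C := by linarith
  refine ⟨M * C * (K₁ + K₀), c, by positivity, hc, fun s => ?_, fun s => ?_⟩
  · -- the odd-moment pairing: subtract `ν(φ) ∫ w = 0`
    have hw0 := hP.integral_expWeight_oddMoment_eq_zero hK hK0 le_rfl hN hT hTL hTR hI0 hI1 hϑ.le hγ hδ0
    set w : PhaseSpace N → ℝ := fun x => Real.exp (-1 / T * Hm x) * (x.2 ⟨0, hN⟩ ^ 2 - x.2 ⟨N - 1, by omega⟩ ^ 2)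
      with hwdef
    have hHc : Continuous Hm := (hP.contDiff_hamiltonian N).continuous
    have hwc : Continuous w := (Real.continuous_exp.comp (continuous_const.mul hHc)).mul
      ((((continuous_apply _).comp continuous_snd).pow 2).sub (((continuous_apply _).comp continuous_snd).pow 2))
    have hIw := hP.integrable_forecast_mul_oddMoment hK hφM hK0 hN hφm hI1 s
    have hwb : ∀ x, |w x| ≤ (1 + x.2 ⟨0, hN⟩ ^ 2 + x.2 ⟨N - 1, by omega⟩ ^ 2) * Real.exp (-1 / T * Hm x) := fun x => by
      rw [hwdef]; simp only
      rw [abs_mul, abs_of_pos (Real.exp_pos _), mul_comm]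
      refine mul_le_mul_of_nonneg_right ?_ (Real.exp_pos _).le
      rw [abs_le]; constructor <;> nlinarith [sq_nonneg (x.2 ⟨0, hN⟩), sq_nonneg (x.2 ⟨N - 1, by omega⟩)]
    have hIcw : Integrable (fun x => (∫ y, φ y ∂ν) * w x) := by
      refine (hI1.mono' hwc.aestronglyMeasurable (Eventually.of_forall fun x => ?_)).const_mul _
      rw [Real.norm_eq_abs]
      refine (hwb x).trans ?_
      rw [show (-1 / T + ϑ) * Hm x = -1 / T * Hm x + ϑ * Hm x by ring, Real.exp_add]
      have h1 : (1 : ℝ) ≤ Real.exp (ϑ * Hm x) := Real.one_le_exp (mul_nonneg hϑ.le (hP.hamiltonian_nonneg N x))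
      have h0 : 0 ≤ (1 + x.2 ⟨0, hN⟩ ^ 2 + x.2 ⟨N - 1, by omega⟩ ^ 2) * Real.exp (-1 / T * Hm x) := by positivity
      nlinarith
    have hsub : ∫ x, (∫ y, φ y ∂(P.langevinKernel N (T + δ / 2) (T - δ / 2) s x)) * w x =
        ∫ x, ((∫ y, φ y ∂(P.langevinKernel N (T + δ / 2) (T - δ / 2) s x)) - ∫ y, φ y ∂ν) * w x := by
      have e : (fun x => ((∫ y, φ y ∂(P.langevinKernel N (T + δ / 2) (T - δ / 2) s x)) - ∫ y, φ y ∂ν) * w x) =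
          fun x => (∫ y, φ y ∂(P.langevinKernel N (T + δ / 2) (T - δ / 2) s x)) * w x - (∫ y, φ y ∂ν) * w x := by
        funext x; ring
      rw [e, integral_sub hIw hIcw, integral_const_mul, hw0, mul_zero, sub_zero]
    rw [hsub]
    calc |∫ x, ((∫ y, φ y ∂(P.langevinKernel N (T + δ / 2) (T - δ / 2) s x)) - ∫ y, φ y ∂ν) * w x|
        ≤ ∫ x, |((∫ y, φ y ∂(P.langevinKernel N (T + δ / 2) (T - δ / 2) s x)) - ∫ y, φ y ∂ν) * w x| :=
          abs_integral_le_integral_abs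
      _ ≤ ∫ x, M * C * Real.exp (-c * s) * ((1 + x.2 ⟨0, hN⟩ ^ 2 + x.2 ⟨N - 1, by omega⟩ ^ 2) *
            Real.exp ((-1 / T + ϑ) * Hm x)) := by
          refine integral_mono_of_nonneg (Eventually.of_forall fun x => abs_nonneg _) (hI1.const_mul _)
            (Eventually.of_forall fun x => ?_)
          dsimp only
          rw [abs_mul]
          calc _ ≤ (M * C * Real.exp (ϑ * Hm x) * Real.exp (-c * s)) *
                ((1 + x.2 ⟨0, hN⟩ ^ 2 + x.2 ⟨N - 1, by omega⟩ ^ 2) * Real.exp (-1 / T * Hm x)) :=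
                mul_le_mul (hdecay s x) (hwb x) (abs_nonneg _) (by positivity)
            _ = _ := by
                rw [show (-1 / T + ϑ) * Hm x = -1 / T * Hm x + ϑ * Hm x by ring, Real.exp_add]; ring
      _ = M * C * Real.exp (-c * s) * K₁ := integral_const_mul _ _
      _ ≤ M * C * (K₁ + K₀) * Real.exp (-c * s) := by
          have : 0 ≤ M * C * Real.exp (-c * s) * K₀ := by positivity
          nlinarith
  · -- the weighted forecast
    have hIf := hP.integrable_expWeight_mul_forecast hK hφM hK0 hφm hI0 s
    have hIe : Integrable fun x : PhaseSpace N => Real.exp (-1 / T * Hm x) :=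
      hZ _ (by rw [neg_div, neg_lt_zero]; positivity)
    have hsub : (∫ x, Real.exp (-1 / T * Hm x) * ∫ y, φ y ∂(P.langevinKernel N (T + δ / 2) (T - δ / 2) s x)) -
        (∫ y, φ y ∂ν) * ∫ x, Real.exp (-1 / T * Hm x) =
        ∫ x, Real.exp (-1 / T * Hm x) *
          ((∫ y, φ y ∂(P.langevinKernel N (T + δ / 2) (T - δ / 2) s x)) - ∫ y, φ y ∂ν) := by
      rw [← integral_const_mul, ← integral_sub hIf (hIe.const_mul _)]
      exact integral_congr_ae (Eventually.of_forall fun x => by ring)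
    rw [hsub]
    calc |∫ x, Real.exp (-1 / T * Hm x) * ((∫ y, φ y ∂(P.langevinKernel N (T + δ / 2) (T - δ / 2) s x)) - ∫ y, φ y ∂ν)|
        ≤ ∫ x, |Real.exp (-1 / T * Hm x) * ((∫ y, φ y ∂(P.langevinKernel N (T + δ / 2) (T - δ / 2) s x)) - ∫ y, φ y ∂ν)| :=
          abs_integral_le_integral_abs
      _ ≤ ∫ x, M * C * Real.exp (-c * s) * Real.exp ((-1 / T + ϑ) * Hm x) := by
          refine integral_mono_of_nonneg (Eventually.of_forall fun x => abs_nonneg _) (hI0.const_mul _)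
            (Eventually.of_forall fun x => ?_)
          dsimp only
          rw [abs_mul, abs_of_pos (Real.exp_pos _)]
          calc _ ≤ Real.exp (-1 / T * Hm x) * (M * C * Real.exp (ϑ * Hm x) * Real.exp (-c * s)) :=
                mul_le_mul_of_nonneg_left (hdecay s x) (Real.exp_pos _).le
            _ = _ := by
                rw [show (-1 / T + ϑ) * Hm x = -1 / T * Hm x + ϑ * Hm x by ring, Real.exp_add]; ring
      _ = M * C * Real.exp (-c * s) * K₀ := integral_const_mul _ _
      _ ≤ M * C * (K₁ + K₀) * Real.exp (-c * s) := by
          have : 0 ≤ M * C * Real.exp (-c * s) * K₁ := by positivity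
          nlinarith

/-- **The odd-moment pairing is integrable on `(0,∞)`** (measurable in time, exponentially small).
[cite: CuneoEckmannHairerReyBellet2018, Thm 2.13 eq. (2.5)] -/
theorem integrableOn_oddMoment_pairing_of_mixing :
    IntegrableOn (fun s : ℝ => ∫ x, (∫ y, φ y ∂(P.langevinKernel N (T + δ / 2) (T - δ / 2) s.toNNReal x)) *
        (Real.exp (-1 / T * P.hamiltonian N x) * (x.2 ⟨0, hN⟩ ^ 2 - x.2 ⟨N - 1, by omega⟩ ^ 2))) (Ioi 0) := by
  obtain ⟨K, c', hK, hc', hk, -⟩ := hP.exists_decay_oddMoment_pairing_of_mixing hN hγ hT hTL hTR hδ0 hϑ hϑT hc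
    hνC hmix hZ hφ2 hφ
  have hmeas := hP.measurable_oddMoment_pairing hN (T := T) (δ := δ) hφ2.continuous.stronglyMeasurable
  refine Integrable.mono' ((exp_neg_integrableOn_Ioi 0 hc').const_mul K) hmeas.aestronglyMeasurable ?_
  refine (ae_restrict_iff' measurableSet_Ioi).2 (Eventually.of_forall fun s hs => ?_)
  rw [Real.norm_eq_abs]
  have h := hk s.toNNReal
  rwa [Real.coe_toNNReal _ (le_of_lt hs)] at h

/-- **★ in Lebesgue-weight form.** Letting `t → ∞` in the finite-time response identity:
`ν(φ) · ∫ e^{-H/T} dx - ∫ e^{-H/T} φ dx = δ (γ/2T²) ∫₀^∞ ∫ P^δ_s φ · e^{-H/T}(p_0² - p_{N-1}²) dx ds`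
(the left side is the limit of `∫ e^{-H/T} P^δ_t φ dx - ∫ e^{-H/T} φ dx`, the right side of the time
integral, both by the exponential relaxation). [cite: KunduDharNarayan2009, p. 3] -/
theorem forecast_limit_mul_partition_eq_of_mixing :
    (∫ y, φ y ∂ν) * (∫ x, Real.exp (-1 / T * P.hamiltonian N x)) - ∫ x, Real.exp (-1 / T * P.hamiltonian N x) * φ x =
      δ * (P.γ / (2 * T ^ 2)) * ∫ s in Ioi (0 : ℝ),
        ∫ x, (∫ y, φ y ∂(P.langevinKernel N (T + δ / 2) (T - δ / 2) s.toNNReal x)) *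
          (Real.exp (-1 / T * P.hamiltonian N x) * (x.2 ⟨0, hN⟩ ^ 2 - x.2 ⟨N - 1, by omega⟩ ^ 2)) := by
  set Hm := P.hamiltonian N with hHm
  obtain ⟨-, hK⟩ := hP.exp_moment_bound_of_mixing N (T + δ / 2) (T - δ / 2) hϑ.le hc.le hνC hmix
  have hK0 : (0 : ℝ) ≤ 2 * C := by
    have h := hmix 0 0 (fun _ => 0) continuous_const (fun y => by rw [abs_zero]; exact (Real.exp_pos _).le)
    simp only [integral_zero, sub_self, abs_zero, NNReal.coe_zero, mul_zero, Real.exp_zero, mul_one] at h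
    nlinarith [nonneg_of_mul_nonneg_left h (Real.exp_pos _)]
  have hI0 : Integrable fun x : PhaseSpace N => Real.exp ((-1 / T + ϑ) * Hm x) := hZ _ hϑT
  have hI1 : Integrable fun x : PhaseSpace N =>
      (1 + x.2 ⟨0, hN⟩ ^ 2 + x.2 ⟨N - 1, by omega⟩ ^ 2) * Real.exp ((-1 / T + ϑ) * Hm x) :=
    hP.integrable_momentSq_mul_exp_mul_hamiltonian hN hϑT (hZ _ (by linarith))
  -- the finite-time identity
  have hft := fun t : ℝ≥0 =>
    hP.finite_time_response_identity hK hK0 le_rfl hN hT hTL hTR hI0 hI1 hφ2 hφ t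
  -- the two limits as `t → ∞`
  obtain ⟨K, c', hK', hc', -, hconv⟩ := hP.exists_decay_oddMoment_pairing_of_mixing hN hγ hT hTL hTR hδ0 hϑ hϑT hc
    hνC hmix hZ hφ2 hφ
  have hcoe : Tendsto (fun t : ℝ≥0 => (t : ℝ)) atTop atTop := NNReal.tendsto_coe_atTop.2 tendsto_id
  have hexp : Tendsto (fun t : ℝ≥0 => K * Real.exp (-c' * t)) atTop (𝓝 0) := by
    have h1 : Tendsto (fun t : ℝ≥0 => c' * (t : ℝ)) atTop atTop := hcoe.const_mul_atTop hc'
    have h2 := Real.tendsto_exp_neg_atTop_nhds_zero.comp h1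
    have h3 : Tendsto (fun t : ℝ≥0 => K * Real.exp (-(c' * (t : ℝ)))) atTop (𝓝 (K * 0)) := h2.const_mul K
    rw [mul_zero] at h3
    refine h3.congr fun t => ?_
    rw [neg_mul]
  have hlim1 : Tendsto (fun t : ℝ≥0 => (∫ x, Real.exp (-1 / T * Hm x) *
      ∫ y, φ y ∂(P.langevinKernel N (T + δ / 2) (T - δ / 2) t x)) - ∫ x, Real.exp (-1 / T * Hm x) * φ x) atTop
      (𝓝 ((∫ y, φ y ∂ν) * (∫ x, Real.exp (-1 / T * Hm x)) - ∫ x, Real.exp (-1 / T * Hm x) * φ x)) := by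
    refine Tendsto.sub_const ?_ _
    refine tendsto_iff_norm_sub_tendsto_zero.2 (squeeze_zero_norm (fun t => ?_) hexp)
    rw [norm_norm, Real.norm_eq_abs]
    exact hconv t
  have hint := hP.integrableOn_oddMoment_pairing_of_mixing hN hγ hT hTL hTR hδ0 hϑ hϑT hc hνC hmix hZ hφ2 hφ
  have hlim2 := (intervalIntegral_tendsto_integral_Ioi 0 hint hcoe).const_mul (δ * (P.γ / (2 * T ^ 2)))
  have hlim2' : Tendsto (fun t : ℝ≥0 => (∫ x, Real.exp (-1 / T * Hm x) *
      ∫ y, φ y ∂(P.langevinKernel N (T + δ / 2) (T - δ / 2) t x)) - ∫ x, Real.exp (-1 / T * Hm x) * φ x) atTop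
      (𝓝 (δ * (P.γ / (2 * T ^ 2)) * ∫ s in Ioi (0 : ℝ),
        ∫ x, (∫ y, φ y ∂(P.langevinKernel N (T + δ / 2) (T - δ / 2) s.toNNReal x)) *
          (Real.exp (-1 / T * Hm x) * (x.2 ⟨0, hN⟩ ^ 2 - x.2 ⟨N - 1, by omega⟩ ^ 2)))) :=
    hlim2.congr fun t => (hft t).symm
  exact tendsto_nhds_unique hlim1 hlim2'

end Star

end SiteChain.UniformlyConfining

end Literature.MathematicalPhysics.KineticTheory.HeatConduction
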